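import Summits.ResolutionOfSingularities.ResolutionOfSingularities.Theses.HilbertSamuelElimination
import Summits.ResolutionOfSingularities.ResolutionOfSingularities.Theorems.HilbertSamuelEliminationModificationsResolve
import Summits.ResolutionOfSingularities.ResolutionOfSingularities.Theorems.HilbertSamuelEliminationSigmaMaxModificationsSplit
import HarnessLib

/-!
# Route `HilbertSamuelElimination` — `Assembly` (item stmt-ResolutionOfSingularities-19248)

[OURS · L1 W4.2] The assembly item of route `HilbertSamuelElimination` (rev 4) reads

  `Assembly := SigmaMaxModificationsLowDim → SigmaMaxModificationsCorridor3 →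
    SigmaMaxModificationsDimGe4 → _root_.ResolutionOfSingularities`.

It is three lines over landed theorems: the fact-free split glue
`Theorems.SigmaMaxModifications.Split.SigmaMaxModifications_of_subs : LowDim → Corridor3 → DimGe4 →
SigmaMaxModifications` (p164111; trichotomy on `dim X` and excluded middle on the corridor
condition) followed by the PROVED bridge `Theorems.ModificationsResolve_proof :
SigmaMaxModifications → ∀ p prime, ResolutionInChar p` (CJS Cor. 6.18 over the proved Thm. 6.17),
and `_root_.ResolutionOfSingularities` IS `∀ p prime, ResolutionInChar p` (`Iff.rfl`,
`_root_.ResolutionOfSingularities_iff`). All the mathematics of the route lives in the three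
hypotheses (items stmt-…-19251 LowDim = print debt, stmt-…-19249 Corridor3 = the attacked conjunct,
stmt-…-19250 DimGe4 = the declared residual); this file only records, as a citable theorem, that
they assemble. NOT a statement of any manuscript.

## Sources

* V. Cossart, U. Jannsen, S. Saito, LNM 2270 (2020), Def. 6.15, Thm. 6.17, Cor. 6.18.
  [CossartJannsenSaito2020]
-/

set_option linter.dupNamespace false -- mandated namespace of this single-conjunct summit

noncomputable section

namespace Summit.ResolutionOfSingularities.ResolutionOfSingularities.Theorems

open Summit.ResolutionOfSingularities.ResolutionOfSingularities.Theses.HilbertSamuelElimination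

/-- **Assembly of route HilbertSamuelElimination** (item stmt-ResolutionOfSingularities-19248):
the three dimension-graded pieces of `SigmaMaxModifications` — `SigmaMaxModificationsLowDim`
(`dim X ≤ 2`, or `dim X ≤ 3` with isolated Hilbert–Samuel locus), `SigmaMaxModificationsCorridor3`
(`dim X = 3`, corridor) and `SigmaMaxModificationsDimGe4` (`dim X ≥ 4`) — imply resolution of
singularities in every positive characteristic. Proof: the landed split glue
`SigmaMaxModifications.Split.SigmaMaxModifications_of_subs` (p164111) gives
`SigmaMaxModifications`, and the proved crux `ModificationsResolve_proof` (CJS Cor. 6.18 over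
Thm. 6.17) turns it into `ResolutionInChar p` for every prime `p`, which is
`_root_.ResolutionOfSingularities` by `rfl`. [cite: CossartJannsenSaito2020, Cor. 6.18] -/
theorem hilbertSamuelElimination_assembly_proof :
    Summit.ResolutionOfSingularities.ResolutionOfSingularities.Theses.HilbertSamuelElimination.Assembly := by
  unfold Assembly
  intro h₁ h₂ h₃
  rw [_root_.ResolutionOfSingularities_iff]
  intro p hp
  exact ModificationsResolve_proof
    (SigmaMaxModifications.Split.SigmaMaxModifications_of_subs h₁ h₂ h₃) p hp

end Summit.ResolutionOfSingularities.ResolutionOfSingularities.Theorems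

end
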